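import Mathlib
import Summits.Ventures.PercRepro2.SwOutAdjBlockCore

/-!
# The edge sets along a block, core form (blind cell PercRepro2, night-4 g32, 2026-08-28;
proofs/NIGHT4-G32.md §2)

Night-4 g11's monotonicity lemmas of SwOutAdjIneq — the red edge set of `h` grows along the
product cube of a block, the blue one shrinks, the total flip exchanges them — restated for a
configuration `ζ₁` whose cores lie in `{h} ∪ J` (SwOutAdjBlockCore), independent of the side.
Every proof is g11's with `hcore₁` in place of `hout` / `hζ₁`.
-/

namespace Summit.Ventures.PercRepro2

namespace LocRows

open Hull

variable {V : Type*} {E : Type*} [Fintype E] [DecidableEq E]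

open scoped Classical

section IneqCore

variable {ends : E → Sym2 V} {h : V} {J : Set V}

variable (hloop_h : ∀ e, ends e ≠ s(h, h)) (hhJ : h ∉ J)
  (hadj : ∀ u ∈ J, ∀ e (he : u ∈ ends e), Sym2.Mem.other he ≠ h →
    ∃ e', ends e' = s(Sym2.Mem.other he, h))

variable {ζ₁ : Config E}
  (hcore₁ : ∀ x, x ∈ cluster ends ζ₁ h → x ∈ cluster ends (blue ζ₁) h → x = h ∨ x ∈ J)

omit [DecidableEq E] in
include hhJ hcore₁ in
/-- The split red edge set grows along the block. -/
lemma redEdges_split_blockReal_mono_core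
    {ω ω' : Config (BlockIdx ends (aSet ends J h ζ₁) h ζ₁)} (hω : ω ≤ ω') :
    redEdges (splitEndsS ends (aSet ends J h ζ₁))
        (blockReal ends (aSet ends J h ζ₁) h ζ₁ ω) (Sum.inl h) ⊆
      redEdges (splitEndsS ends (aSet ends J h ζ₁))
        (blockReal ends (aSet ends J h ζ₁) h ζ₁ ω') (Sum.inl h) := by
  rw [redEdges_splitS_congr (blockReal_agree ω), redEdges_splitS_congr (blockReal_agree ω')]
  exact redEdges_orbitReal_mono (coreFree_blockBase_core hhJ hcore₁) fun P => hω (Sum.inl P)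

omit [DecidableEq E] in
include hloop_h hhJ hcore₁ in
/-- The split blue edge set shrinks along the block. -/
lemma blueEdges_split_blockReal_anti_core
    {ω ω' : Config (BlockIdx ends (aSet ends J h ζ₁) h ζ₁)} (hω : ω ≤ ω') :
    blueEdges (splitEndsS ends (aSet ends J h ζ₁))
        (blockReal ends (aSet ends J h ζ₁) h ζ₁ ω') (Sum.inl h) ⊆
      blueEdges (splitEndsS ends (aSet ends J h ζ₁))
        (blockReal ends (aSet ends J h ζ₁) h ζ₁ ω) (Sum.inl h) := by
  rw [blueEdges_splitS_congr (blockReal_agree ω), blueEdges_splitS_congr (blockReal_agree ω')]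
  exact blueEdges_orbitReal_anti (coreFree_blockBase_core hhJ hcore₁)
    (splitEndsS_ne_loop_h hloop_h) fun P => hω (Sum.inl P)

omit [DecidableEq E] in
include hloop_h hhJ hcore₁ in
/-- The total flip exchanges the split edge sets. -/
lemma blueEdges_split_blockReal_flipAll_core
    (ω : Config (BlockIdx ends (aSet ends J h ζ₁) h ζ₁)) :
    blueEdges (splitEndsS ends (aSet ends J h ζ₁))
        (blockReal ends (aSet ends J h ζ₁) h ζ₁ (flipAll ω)) (Sum.inl h) =
      redEdges (splitEndsS ends (aSet ends J h ζ₁))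
        (blockReal ends (aSet ends J h ζ₁) h ζ₁ ω) (Sum.inl h) := by
  rw [blueEdges_splitS_congr (blockReal_agree (flipAll ω)),
    redEdges_splitS_congr (blockReal_agree ω)]
  exact blueEdges_orbitReal_flipAll (coreFree_blockBase_core hhJ hcore₁)
    (splitEndsS_ne_loop_h hloop_h) (ω ∘ Sum.inl)

omit [DecidableEq E] in
include hhJ hadj hcore₁ in
/-- The active set grows along the block. -/
lemma activeRed_blockReal_mono_core
    {ω ω' : Config (BlockIdx ends (aSet ends J h ζ₁) h ζ₁)} (hω : ω ≤ ω') :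
    activeRed ends (aSet ends J h ζ₁) (blockReal ends (aSet ends J h ζ₁) h ζ₁ ω) ⊆
      activeRed ends (aSet ends J h ζ₁) (blockReal ends (aSet ends J h ζ₁) h ζ₁ ω') := by
  rintro w ⟨hwM, e, hwe, hi, hred⟩
  refine ⟨hwM, e, hwe, hi, ?_⟩
  have h1 := (mem_redEdges_splitS_iff_of_afine (afine_blockReal_core hhJ hadj hcore₁ ω)
    hwM hwe hi).2 hred
  exact (mem_redEdges_splitS_iff_of_afine (afine_blockReal_core hhJ hadj hcore₁ ω') hwM hwe
    hi).1 (redEdges_split_blockReal_mono_core hhJ hcore₁ hω h1)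

omit [DecidableEq E] in
include hhJ hadj hcore₁ in
/-- **The red edge set grows along the block.** -/
theorem redEdges_blockReal_mono_core
    {ω ω' : Config (BlockIdx ends (aSet ends J h ζ₁) h ζ₁)} (hω : ω ≤ ω') :
    redEdges ends (blockReal ends (aSet ends J h ζ₁) h ζ₁ ω) h ⊆
      redEdges ends (blockReal ends (aSet ends J h ζ₁) h ζ₁ ω') h := by
  have hhM : h ∉ aSet ends J h ζ₁ := fun h' => hhJ (aSet_subset h')
  rw [redEdges_eq_of_afine hhM (afine_blockReal_core hhJ hadj hcore₁ ω),
    redEdges_eq_of_afine hhM (afine_blockReal_core hhJ hadj hcore₁ ω')]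
  refine Set.union_subset_union (redEdges_split_blockReal_mono_core hhJ hcore₁ hω) ?_
  rintro e ⟨hi, hred, hI⟩
  have hint : ∀ e', Internal ends (aSet ends J h ζ₁) e' →
      blockReal ends (aSet ends J h ζ₁) h ζ₁ ω e' = true →
      blockReal ends (aSet ends J h ζ₁) h ζ₁ ω' e' = true := by
    intro e' hi' h'
    rw [blockReal_of_internal ω' hi']
    rw [blockReal_of_internal ω hi'] at h'
    exact bool_eq_true_of_le (hω (Sum.inr ⟨e', hi'⟩)) h'
  exact ⟨hi, hint e hi hred, fun x hx =>
    intCluster_mono hint (activeRed_blockReal_mono_core hhJ hadj hcore₁ hω) (hI x hx)⟩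

omit [DecidableEq E] in
include hloop_h hhJ hadj hcore₁ in
/-- The blue active set shrinks along the block. -/
lemma activeRed_blue_blockReal_anti_core
    {ω ω' : Config (BlockIdx ends (aSet ends J h ζ₁) h ζ₁)} (hω : ω ≤ ω') :
    activeRed ends (aSet ends J h ζ₁) (blue (blockReal ends (aSet ends J h ζ₁) h ζ₁ ω')) ⊆
      activeRed ends (aSet ends J h ζ₁) (blue (blockReal ends (aSet ends J h ζ₁) h ζ₁ ω)) := by
  rintro w ⟨hwM, e, hwe, hi, hblue⟩
  refine ⟨hwM, e, hwe, hi, ?_⟩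
  have h1 := (mem_redEdges_splitS_iff_of_afine
    (afine_blue_iff.2 (afine_blockReal_core hhJ hadj hcore₁ ω')) hwM hwe hi).2 hblue
  exact (mem_redEdges_splitS_iff_of_afine
    (afine_blue_iff.2 (afine_blockReal_core hhJ hadj hcore₁ ω)) hwM hwe hi).1
    (blueEdges_split_blockReal_anti_core hloop_h hhJ hcore₁ hω h1)

omit [DecidableEq E] in
include hloop_h hhJ hadj hcore₁ in
/-- **The blue edge set shrinks along the block.** -/
theorem blueEdges_blockReal_anti_core
    {ω ω' : Config (BlockIdx ends (aSet ends J h ζ₁) h ζ₁)} (hω : ω ≤ ω') :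
    blueEdges ends (blockReal ends (aSet ends J h ζ₁) h ζ₁ ω') h ⊆
      blueEdges ends (blockReal ends (aSet ends J h ζ₁) h ζ₁ ω) h := by
  have hhM : h ∉ aSet ends J h ζ₁ := fun h' => hhJ (aSet_subset h')
  rw [blueEdges_eq_of_afine hhM (afine_blockReal_core hhJ hadj hcore₁ ω),
    blueEdges_eq_of_afine hhM (afine_blockReal_core hhJ hadj hcore₁ ω')]
  refine Set.union_subset_union (blueEdges_split_blockReal_anti_core hloop_h hhJ hcore₁ hω) ?_
  rintro e ⟨hi, hblue, hI⟩
  have hint : ∀ e', Internal ends (aSet ends J h ζ₁) e' →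
      blue (blockReal ends (aSet ends J h ζ₁) h ζ₁ ω') e' = true →
      blue (blockReal ends (aSet ends J h ζ₁) h ζ₁ ω) e' = true := by
    intro e' hi' h'
    rw [blue_eq_true_iff, blockReal_of_internal ω hi']
    rw [blue_eq_true_iff, blockReal_of_internal ω' hi'] at h'
    exact bool_eq_false_of_le (hω (Sum.inr ⟨e', hi'⟩)) h'
  exact ⟨hi, hint e hi hblue, fun x hx =>
    intCluster_mono hint (activeRed_blue_blockReal_anti_core hloop_h hhJ hadj hcore₁ hω)
      (hI x hx)⟩

omit [DecidableEq E] in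
include hloop_h hhJ hadj hcore₁ in
/-- The total flip exchanges the active sets. -/
lemma activeRed_blue_blockReal_flipAll_core
    (ω : Config (BlockIdx ends (aSet ends J h ζ₁) h ζ₁)) :
    activeRed ends (aSet ends J h ζ₁)
        (blue (blockReal ends (aSet ends J h ζ₁) h ζ₁ (flipAll ω))) =
      activeRed ends (aSet ends J h ζ₁) (blockReal ends (aSet ends J h ζ₁) h ζ₁ ω) := by
  ext w
  simp only [activeRed, Set.mem_setOf_eq]
  refine and_congr_right fun hwM => exists_congr fun e => and_congr_right fun hwe =>
    and_congr_right fun hi => ?_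
  rw [← mem_redEdges_splitS_iff_of_afine
    (afine_blue_iff.2 (afine_blockReal_core hhJ hadj hcore₁ (flipAll ω))) hwM hwe hi,
    ← mem_redEdges_splitS_iff_of_afine (afine_blockReal_core hhJ hadj hcore₁ ω) hwM hwe hi]
  exact Set.ext_iff.1 (blueEdges_split_blockReal_flipAll_core hloop_h hhJ hcore₁ ω) e

omit [DecidableEq E] in
include hloop_h hhJ hadj hcore₁ in
/-- **The total flip exchanges the edge sets.** -/
theorem blueEdges_blockReal_flipAll_core
    (ω : Config (BlockIdx ends (aSet ends J h ζ₁) h ζ₁)) :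
    blueEdges ends (blockReal ends (aSet ends J h ζ₁) h ζ₁ (flipAll ω)) h =
      redEdges ends (blockReal ends (aSet ends J h ζ₁) h ζ₁ ω) h := by
  have hhM : h ∉ aSet ends J h ζ₁ := fun h' => hhJ (aSet_subset h')
  rw [blueEdges_eq_of_afine hhM (afine_blockReal_core hhJ hadj hcore₁ (flipAll ω)),
    redEdges_eq_of_afine hhM (afine_blockReal_core hhJ hadj hcore₁ ω),
    blueEdges_split_blockReal_flipAll_core hloop_h hhJ hcore₁ ω]
  congr 1
  have hint : ∀ e', Internal ends (aSet ends J h ζ₁) e' →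
      blue (blockReal ends (aSet ends J h ζ₁) h ζ₁ (flipAll ω)) e' =
        blockReal ends (aSet ends J h ζ₁) h ζ₁ ω e' := by
    intro e' hi'
    rw [blue_apply, blockReal_of_internal (flipAll ω) hi', blockReal_of_internal ω hi']
    simp only [flipAll, Bool.not_not]
  have hact := activeRed_blue_blockReal_flipAll_core hloop_h hhJ hadj hcore₁ ω
  have hI : intCluster ends (aSet ends J h ζ₁) h
      (blue (blockReal ends (aSet ends J h ζ₁) h ζ₁ (flipAll ω))) =
      intCluster ends (aSet ends J h ζ₁) h (blockReal ends (aSet ends J h ζ₁) h ζ₁ ω) :=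
    Set.Subset.antisymm
      (intCluster_mono (fun e' hi' h' => by rw [← hint e' hi']; exact h') hact.le)
      (intCluster_mono (fun e' hi' h' => by rw [hint e' hi']; exact h') hact.ge)
  ext e
  simp only [Set.mem_setOf_eq]
  constructor
  · rintro ⟨hi, hb, hI'⟩
    exact ⟨hi, by rw [← hint e hi]; exact hb, fun x hx => hI ▸ hI' x hx⟩
  · rintro ⟨hi, hb, hI'⟩
    exact ⟨hi, by rw [hint e hi]; exact hb, fun x hx => hI.symm ▸ hI' x hx⟩

end IneqCore

end LocRows

end Summit.Ventures.PercRepro2
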